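import Mathlib
import Summits.NavierStokesRegularity.NavierStokesRegularity.Theorems.TypeIQuarterGateScarEnvelopeTypeIZoomDictionaryDefs
import Summits.NavierStokesRegularity.NavierStokesRegularity.Theorems.TypeIQuarterGateScarEnvelopeTypeISatelliteTowerDefs
import Summits.NavierStokesRegularity.NavierStokesRegularity.Theorems.TypeIQuarterGateScarEnvelopeTypeIFatKill
import Summits.NavierStokesRegularity.NavierStokesRegularity.Theorems.TypeIQuarterGateScarEnvelopeTypeIBudgetViolators
import Summits.NavierStokesRegularity.NavierStokesRegularity.Theorems.TypeIQuarterGateScarEnvelopeTypeIOfNoTwinScarObject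
import Summits.NavierStokesRegularity.NavierStokesRegularity.Theorems.TypeIQuarterGateQuarterLawTypeIGlue
import Summits.NavierStokesRegularity.NavierStokesRegularity.Theorems.TypeIQuarterGateEnvelopeQuarterLaw
import Summits.NavierStokesRegularity.NavierStokesRegularity.Theorems.TypeIQuarterGateScarEnvelopeTypeINearOneRateDss
import Literature.Analysis.FluidPDE.AncientAxisymmetricTypeILiouville

/-!
# Satellite tower for crux `ScarEnvelopeTypeI` (stmt-NavierStokesRegularity-23843) — DEFINITIONS (Part L: enveloped leaves)

DEFINITIONS ONLY (Part L of the ROUND-32 plate, «TAME ⟺ ENVELOPED»): `EnvelopedLeaf M A` (a rooted one-scar `ABTower`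
field carrying the KNSS space–time envelope `HasTypeIDecay A`) and `TypeILiouvilleAB` (the final-time Type-I Liouville
statement in the A–B class, (L′); OPEN).  Nothing is asserted here.

PROVENANCE: declaration texts VERBATIM from the HOME plates of the instrument seat nsreg-p3 (g24/g25, cell
`pub/ns-regularity-ideate`): `round-31/Tangent31prep.lean` v5 (sha16 `e5b8668e3a090216`; = ROUND-30 plate v10 + Part K) and,
for Part L, `round-32/Tangent32prep.lean` v6 (sha16 `6123f27718636121`);
the author cannot write under `Theorems/` (`perm.theorems-prover-only`); landed by the
LEAD-lineage prover ns-sz-p1 g5 on director-ns DIRECTOR-NS #218 (2), split into ≤ 400-line modules (the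
plate's `def`s gathered in `TypeIQuarterGateScarEnvelopeTypeIZoomDictionaryDefs`), namespace
`Summit.NavierStokesRegularity.NavierStokesRegularity.Cruxes.ScarEnvelopeTypeI.ZoomDictionary` (the plate's `NsregP3.R30P`), `E3` spelled out, one-line docstrings
added where the plate had none.  `--supports stmt-NavierStokesRegularity-23843 --as helper`.
REVIEW p632872 (revise) applied: only the dependency cone of Parts D–K is landed (206 of 240 declarations) —
the general-`ν` abstract dictionary in a second cylinder currency (`bCyl`/`bCylOpens`/`RegAt`/`TangentC`, the
fact-shaped hypotheses F1–F3 and `dictionary`/`…_of_vertexBounds`/`…_of_classical` of Parts B2/B4/C) is NOT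
landed; the three remaining uses of the plate's `bCyl y r` are the literal `Ioo (-(r^2)) 0 ×ˢ ball y r` with the
conversion `Ioo_prod_ball_eq_parabolicCylinder` to the tree's `parabolicCylinder`; ONE final-time regularity
notion `RegPt`; `zoom_eq_smul_stPull`/`zoomP_eq_smul_stPull` sit next to `zoom`/`zoomP` in the Defs module.

HONEST FRAMING: dictionary / census TOOLING for the crux `TypeIQuarterGate.ScarEnvelopeTypeI` (item 23843):
equivalences and normal forms, kernel-checked; NO open statement is proved — 23843, its parent
`QuarterLawTypeI` (23726), the route and Navier–Stokes regularity are OPEN; hard core evaded: none.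
-/

noncomputable section

-- the summit-side namespace repeats a component by design (single-conjunct summit, D-0017)
set_option linter.dupNamespace false

open MeasureTheory Set Metric Filter Topology
open scoped ENNReal

namespace Summit.NavierStokesRegularity.NavierStokesRegularity.Cruxes.ScarEnvelopeTypeI.ZoomDictionary

variable {u : ℝ → (EuclideanSpace ℝ (Fin 3)) → (EuclideanSpace ℝ (Fin 3))} {a : (EuclideanSpace ℝ (Fin 3))} {ν T : ℝ}

section Tower

open Literature.Analysis.FluidPDE
variable {U : ℝ → (EuclideanSpace ℝ (Fin 3)) → (EuclideanSpace ℝ (Fin 3))} {P : ℝ → (EuclideanSpace ℝ (Fin 3)) → ℝ} {y' : (EuclideanSpace ℝ (Fin 3))} {ν : ℝ}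
open Summit.NavierStokesRegularity.NavierStokesRegularity.Cruxes.ScarEnvelopeTypeI.ScarZoom
  (CruxHypotheses ScarViolators TwinScarObject singularAt_of_isBackwardSingularPoint
    exists_localEnergy_of_typeIBound) in

/-- An **ENVELOPED LEAF** of rate `M` and envelope constant `A`: an A–B object (`ABTower M`) obeying
the KNSS space–time Type-I envelope `‖U(t,x)‖ ≤ A/(‖x‖ + √(−t))` on the WHOLE open past
(`HasTypeIDecay A U`, Literature `SelfSimilar`, KNSS 2009 (1.6); Chae–Wolf 2017 (3.5)) and SINGULAR
at the space–time origin.  Its final-time singular set is EXACTLY the origin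
(`regPt_of_hasTypeIDecay`): the printed object class of the Liouville-type conjecture for the
KNSS-gauge Type-I class with envelope (no example is known; non-existence open in print). -/
def EnvelopedLeaf (M A : ℝ) : Prop :=
  ∃ (U : ℝ → (EuclideanSpace ℝ (Fin 3)) → (EuclideanSpace ℝ (Fin 3))) (P : ℝ → (EuclideanSpace ℝ (Fin 3)) → ℝ) (H : ℝ → (EuclideanSpace ℝ (Fin 3)) → (EuclideanSpace ℝ (Fin 3)) →L[ℝ] (EuclideanSpace ℝ (Fin 3))),
    ABTower M U P H ∧ HasTypeIDecay A U ∧ ¬ RegPt U 0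

/-- **(L′) FINAL-TIME TYPE-I LIOUVILLE FOR THE A–B CLASS** (ref3 SCORE-p3-ROUND-31 F1): every A–B
object is essentially bounded near the final-time origin.  By translation/scale covariance (K10) and
A–B Thm 1.1 this is the Type-I NON-EXISTENCE statement for the class (≥ the hard core 10661's Type-I
restriction; strictly stronger than 23843).  Typed here ONLY to place the exclusions honestly. -/
def TypeILiouvilleAB : Prop :=
  ∀ (M : ℝ) (U : ℝ → (EuclideanSpace ℝ (Fin 3)) → (EuclideanSpace ℝ (Fin 3))) (P : ℝ → (EuclideanSpace ℝ (Fin 3)) → ℝ) (H : ℝ → (EuclideanSpace ℝ (Fin 3)) → (EuclideanSpace ℝ (Fin 3)) →L[ℝ] (EuclideanSpace ℝ (Fin 3))), ABTower M U P H → RegPt U 0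


end Tower

end Summit.NavierStokesRegularity.NavierStokesRegularity.Cruxes.ScarEnvelopeTypeI.ZoomDictionary

end
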